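import Summits.QuantumFields.BalabanUV.Beta.CombChartJointEndReflTablesAn1S2MWVBScaled
import Summits.QuantumFields.BalabanUV.Beta.CombSecondOrderRemainderAn1Scaled

/-!
# `BalabanUV.Beta.CombChartJointEndReflTablesAn1S2RScaled` — binder row D1, chart (III″) programme (an2 g56 W-3 l.63100 (D4)∕(D5); leaf-04 g33): **THE κ-TWIN OF THE COMB CHAIN ROOT
# `CombChartJointEndReflTablesAn1S2R`** in the ONE-κ currency of RULING R-D1-g56-4 ∕ A-1 l.63035 ∕ W-3 shape (S): literal `JsB12CombShSym hLc N (symTablesAn1S2w 3 Lc (κ·cΛ) κ) (κ·cΛ) cB`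
# (pin `κ·cΛ` in every Λ slot, mixed table `κ • symMixFFAt (ctr 4 Lc) Lc` in every second-order slot, remainders `κ •` the landed ones at the base pin), the Λ-lock
# `cΛ·Lc⁴ = 2` on the BASE pin verbatim where the parent has it, the group weight κ FREE.  R: the second-order remainder ∕ split ∕ recursion binders `R2 Δ h0 hsplit hR2succ` supplied by leaf-03 g50's κ-objects `combR2An1W ∕ combΔAn1W` (P1) BY NAME over leaf-04's MWVBw.
# WHAT CHANGES relative to `CombChartJointEndReflTablesAn1S2R`: nothing but these substitutions (text transformed by name; the parent's bound fine-bond index `κ` is renamed `κ₁`; see the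
# parent and its chart-(II) original for the letter-by-letter account).

HONEST FRAMING (cell contract, verbatim): «discharging `BetaPertH` makes Bałaban's UV stability UNCONDITIONAL — a real constructive-QFT
result; it is NOT the continuum limit and NOT the Clay problem.»  HONEST DEPENDENCY: continuum YM on T⁴ ⇐ BetaPertH ∧ nine spine estimates (0/9 proved);
BetaPertH ⇐ (D1) ∧ (D4) ∧ CAP+tail; G-an2-4 gates asym, D1 and NE2/3/4.
DERIVED cell leaf ([folklore] wiring BY NAME; β sub-cell, D1 formalisation swarm leaf prover 04 `b2b-balaban-beta-d1-formalise-leaf-04` gen 33, on the row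
OWNER an2 g56's programme W-3).  No statement of Bałaban's papers, no `[cite:]`, no `Prop` fact, no `def`; every displayed letter is a BINDER; the VALUE
`κ = Lc¹²∕4` enters nowhere here (the chain is κ-generic).  HONEST: composition by name; root classes 0∕4 discharged; row D1 binders 0∕4; ROOT M‴ p325680 and
the root of record untouched; NOT D1, NOT `BetaPertH`, NOT continuum, NOT Clay.  Provenance: β sub-cell, unit b2b-balaban-beta-d1-formalise-leaf-04 gen 33,
2026-08-25 (v1); over leaf-04's `CombChartJointEndReflTablesAn1S2MWVBScaled` (MWVBw) and leaf-03 g50's `CombSecondOrderRemainderAn1Scaled` (P1) BY NAME; no existing file touched.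
-/

noncomputable section

open Finset
open scoped BigOperators
open Literature.Probability.LatticeModels (Torus.proj)
open Literature.MathematicalPhysics.QuantumFieldTheory
open Literature.MathematicalPhysics.QuantumFieldTheory.Balaban1983to89
open Literature.MathematicalPhysics.QuantumFieldTheory.Balaban1983to89.Beta
open Literature.MathematicalPhysics.QuantumFieldTheory.Balaban1983to89.Beta.VectorTailsLoc (fam kfam)
open Literature.MathematicalPhysics.QuantumFieldTheory.Balaban1983to89.Beta.VectorLegVolumeAdapter (MvE)
open ExpKernelCalculus (MKer BiLoc VertexFamily comp tr tadpole shiftK)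
open PolarizationSign (reflSign WardTransversal AxisReflectionCovariant)
open KernelReflection (refK)
open ResolventReflection (bref Φ)
open AffineAveraging (box toSite)
open AveragingContoursRooted (ctr ctrOff ctrOff_mem_box)
open OneStepResolventKernel (Fib LocStencil JetData)
open OneStepKernelFamily (KInvStep colH vertexOfK TbalOf flipK D1Tel D1Rep D1Drift)
open KernelWard (divV divW)
open StepJetData (mfNeg wilsonA)
open BalabanStepJetsSucc (mmRead wE wVH)
open SecondOrderResponse (dM W2OfK LocStencilFM)
open BalabanCompositeJets (LocStencil₂)
open BalabanStepW2 (M2Of wB2 wV4)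
open WilsonBiStencil (wilsonW₂)
open WilsonVertex2Sym (wsym22)
open Summit.QuantumFields.BalabanUV.Beta.TameKernelCalculus
open Summit.QuantumFields.BalabanUV.Beta.ChartConjugation (conjV conjW)
open Summit.QuantumFields.BalabanUV.Beta.ChartConjugationDefectEnd (conjDefect sandwichDefect)
open Summit.QuantumFields.BalabanUV.Beta.AxialDressingRooted (one_le_of_neZero)
open Summit.QuantumFields.BalabanUV.Beta.SymmetrisedDressingKernel (coDressKSymAt)
open Summit.QuantumFields.BalabanUV.Beta.AveragingWardRootedStencils (legInd)
open Summit.QuantumFields.BalabanUV.Beta.SymmetrisedStepJets (SymTables)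
open Summit.QuantumFields.BalabanUV.Beta.CombChartStepJets (GcombSh ScombOf SpureCombOf JsB12CombSh0)
open Summit.QuantumFields.BalabanUV.Beta.CombChartJointEnd (JsB12CombShSym)
open Summit.QuantumFields.BalabanUV.Beta.SpineRooted (M1Of SpureRecOf T2RecOf WrecOf)
open Summit.QuantumFields.BalabanUV.Beta.WardLocusRecursive (SrecOf)
open Summit.QuantumFields.BalabanUV.Beta.WardLocusCubic (mmSym)
open Summit.QuantumFields.BalabanUV.Beta.SymShiftedSpread (bhKStepSh)
open Summit.QuantumFields.BalabanUV.Beta.BorderedHessian (sgnK bhK stepScale diagK)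
open Summit.QuantumFields.BalabanUV.Beta.E3ContactGenerator (ctGenM)
open Summit.QuantumFields.BalabanUV.Beta.DshAn1 (Dsh)
open Summit.QuantumFields.BalabanUV.Beta.SymAveragingHessianCounts (symVhSAt symHessFFAt)
open Summit.QuantumFields.BalabanUV.Beta.SymAveragingMixedJetTables (symMixFFAt)
open Summit.QuantumFields.BalabanUV.Beta.SymSecondOrderTablesAn1 (symVh₂SAn1)
open Summit.QuantumFields.BalabanUV.Beta.SymTablesAn1S2Weighted (symTablesAn1S2w)
open Summit.QuantumFields.BalabanUV.Beta.SymMixedReflectionLetterAn1 (symRMrAn1)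

open Summit.QuantumFields.BalabanUV.Beta.CombChartJointEndReflTablesAn1S2MWVBScaled (d1Drift_JsB12CombShSym_an1TablesS2w_of_level0ReflLetter_split_D1Tel_D1Rep_of_locks)
open Summit.QuantumFields.BalabanUV.Beta.CombSecondOrderRemainderAn1Scaled (combR2An1W combΔAn1W h0_combW hsplit_combW hR2succ_combW)

namespace Summit.QuantumFields.BalabanUV.Beta.CombChartJointEndReflTablesAn1S2RScaled

variable {Lc : ℕ} [NeZero Lc]

/-- **ROW D1 — THE LITERAL ROOT AT THE WEIGHTED RECORD `symTablesAn1S2w 3 Lc (κ·cΛ) κ`, THE SECOND-ORDER LETTERS SUPPLIED BY leaf-03's κ-OBJECTS**, every group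
weight `κ` — the κ-twin of `CombChartJointEndReflTablesAn1S2R.d1Drift_…_of_locks_contact_loc_hcomp_…`: MWVBw (`CombChartJointEndReflTablesAn1S2MWVBScaled`) with
`R2 := combR2An1W Lc N cΛ κ γ X2s`, `Δ := combΔAn1W Lc N cΛ κ γ X2s`, `h0 := h0_combW`, `hsplit := hsplit_combW`, `hR2succ := hR2succ_combW` (leaf-03 g50's
`CombSecondOrderRemainderAn1Scaled`, O-g50-1 P1 — the landed `combR2An1 ∕ combΔAn1` with the three (S) substitutions; at `κ = 1` they ARE the landed objects by their
`_one` lemmas) BY NAME.  At `κ = 1` this is the parent's statement.  HONEST: composition by name; NOT D1. -/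
theorem d1Drift_JsB12CombShSym_an1TablesS2w_of_locks_contact_loc_hcomp_D1Tel_D1Rep (hLc : Odd Lc) (hL2 : 2 ≤ Lc) {N : ℕ} (hN : 2 ≤ N) (cΛ κ cB : ℝ)
    -- the two unit locks of an1's TABLE-FIT tier 2 (Λ-lock on the BASE pin `cΛ`, VERBATIM; B-lock); the group weight `κ` is FREE
    (hΛ : cΛ * (Lc : ℝ) ^ 4 = 2) (hcB : cB = -((Lc : ℝ) ^ 12 / 4))
    -- the first-order contact coefficient, displayed
    (γ : ℕ → ℝ) (hγ : ∀ j, γ j = -((Lc : ℝ) ^ 8 / 2) * wVH 3 Lc j / (stepScale 3 Lc j * (Lc : ℝ) ^ 4))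
    -- hR, SECOND ORDER: the contact table `X2s` (free) and the three localisations; the table letters are ALL discharged (ROOT H∕I∕J + `SymSecondOrderRemainderAn1`)
    (X2s : ℕ → Fin 4 → Fin 4 → (Fin 4 → ℤ) → Fin 4 → (Fin 4 → ℤ) → (Fin 4 → ℤ) → Fib 3 → ℝ)
    (hDg : ∀ (j : ℕ) (α ν : Fin 4) (y' : Fin 4 → ℤ),
      Loc (dM (GcombSh (d := 3) Lc j) Lc (fun κ₁ u => SpureRecOf 3 Lc (symVhSAt (ctr 4 Lc) 3 Lc rfl) (symHessFFAt (ctr 4 Lc) Lc) (GcombSh Lc) ((Lc : ℝ) ^ 4) (-((Lc : ℝ) ^ 8 / 2)) (κ * cΛ) j κ₁ u + conjV (bhKStepSh 3 Lc (Dsh Lc) j) (diagK fun p c => γ j * ctGenM 3 (bhK Lc + Dsh Lc) α Lc κ₁ u p c)) (M1Of 3 Lc (symHessFFAt (ctr 4 Lc) Lc) (κ * cΛ) j) ν y'))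
    (hX2L : ∀ j α μ y ν y', Loc (diagK (X2s j α μ y ν y'))) (hΔL : ∀ j α μ y ν y', Loc (combΔAn1W Lc N cΛ κ γ X2s j α μ y ν y'))
    -- the cancellation of the chart-(II) defect against the W-REMAINDER `Rm_j` (the compensator is now IDENTIFIED: `Wc := Rm`, `X₂ := diagK X2s`) — the (N8) object
    (hRm0 : ∀ (j : ℕ) (α μ : Fin 4) (y : Fin 4 → ℤ) (ν : Fin 4) (y' : Fin 4 → ℤ),
      tadpole (GcombSh Lc j)
        ((1 / 2 : ℝ) • conjV (bhKStepSh 3 Lc (Dsh Lc) j) (diagK fun p a => X2s j α ν y' μ y p a - X2s j α μ y ν y' p a) +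
          (1 / 2 : ℝ) • (combΔAn1W Lc N cΛ κ γ X2s j α μ y ν y' + combΔAn1W Lc N cΛ κ γ X2s j α ν y' μ y)) = 0)
    -- the route theorem's own binders, verbatim
    (a : ℝ) (ha : 0 < a)
    (h12 : B5.Prop12Printed (fam (fun i : ℕ+ × ℕ => ((i.1 : ℕ+) : ℕ)) (fun i => i.1.pos) MvE a ha))
    (h126 : B5.Kernel126_127Printed (kfam (fun i : ℕ+ × ℕ => ((i.1 : ℕ+) : ℕ)) MvE))
    {L : Type*} {SL : Finset L} (hSL : SL.Nonempty) (k : L → Fin 4) {μ ν : Fin 4} (hμν : μ ≠ ν) {Nc : ℝ} (hNc : Nc ≠ 0)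
    (Jc : ∀ m : ℕ, JetData 3 (Lc ^ m))
    (htel : D1Tel Lc (JsB12CombShSym hLc N (symTablesAn1S2w 3 Lc (κ * cΛ) κ) (κ * cΛ) cB) Jc)
    {cc : ℝ} {Mw' : ℕ → ℕ} (hc : 1 ≤ cc) (hMwin : ∀ L : ℕ, 2 ≤ L → 1 ≤ Mw' L ∧ (L : ℝ) ≤ cc * Mw' L) (hML : ∀ L : ℕ, 2 ≤ L → Mw' L ≤ L)
    (hrep : D1Rep Lc Jc Nc μ ν a SL k) :
    D1Drift Lc (JsB12CombShSym hLc N (symTablesAn1S2w 3 Lc (κ * cΛ) κ) (κ * cΛ) cB) Nc μ ν := by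
  subst hcB
  exact d1Drift_JsB12CombShSym_an1TablesS2w_of_level0ReflLetter_split_D1Tel_D1Rep_of_locks hLc hL2 hN cΛ κ (-((Lc : ℝ) ^ 12 / 4)) hΛ rfl γ hγ
    (combR2An1W Lc N cΛ κ γ X2s) (h0_combW N cΛ κ γ X2s) X2s (combΔAn1W Lc N cΛ κ γ X2s) (hsplit_combW N cΛ κ γ X2s) hDg hX2L hΔL (hR2succ_combW N cΛ κ γ X2s)
    hRm0 a ha h12 h126 hSL k hμν hNc Jc htel hc hMwin hML hrep

end Summit.QuantumFields.BalabanUV.Beta.CombChartJointEndReflTablesAn1S2RScaled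

end
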